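import Summits.KontsevichZagierPeriods.KontsevichZagierPeriods.Theorems.RootDecompQuadraticDescentTRRogersCarvingP1

/-! # `RootDecompQuadraticDescentTRRogersCarvingP2` — part 2/2 of the mechanical ≤400-line split of `TRRogersCarving.lean` (sha256 ac7e0d4223a1c482…)
Source: decomp-kz lens-6 g13 TRRogersCarving.lean @ac7e0d42 (critic CLEARED g6-22 l.1373); --supports stmt-KontsevichZagierPeriods-28994.
Split by census-1 g10 `gen/splitlean.py`: scopes re-opened with their `open`/`variable`/`set_option` context; mathematics and declaration order unchanged. -/

noncomputable section
open MeasureTheory Set MvPolynomial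
open Literature.NumberTheory.Transcendental
open Literature.ModelTheory.ExponentialFields (IsSemialgebraic)
open Summit.KontsevichZagierPeriods.KontsevichZagierPeriods.Theses.RootDecompQuadraticDescent
  (DescentTwoQ KZDimTwo QuadraticDescentOne BakerFloorOne QuadraticDescent DescentThreeQ DescentFourQ DescentFromQ
    FixedDimMerge closes)
namespace Summit.KontsevichZagierPeriods.RootDecompQuadraticDescent.TRRogersCarving

/-- Edge `DescentTwoQ → T` from the `≤ 2` realisation of the real dilogarithm sector, with `N = 1`. [folklore] -/
theorem torsionDilogKernel_of_descentTwoQ (hP : RealDilogRealisationLE) (h : DescentTwoQ) :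
    TorsionDilogKernelModOne := by
  intro R h₁ h₂ h₃ h₄ β hβ F _ _ ι ξ _ y hy hev
  obtain ⟨a, r, b, r', ha2, hb2, hr, hr', hrel⟩ := hP β hβ F ι ξ y hy
  have hker := KZ.relations_le_ker_eval_holds hrel
  rw [AddMonoidHom.mem_ker, map_sub, map_sub, KZ.eval_of, KZ.eval_of, hev, sub_zero, sub_eq_zero] at hker
  have hR : KZ.of r - KZ.of r' ∈ R := h R h₁ h₂ h₃ h₄ ha2 hb2 r r' hr hr' hker
  refine ⟨1, one_pos, ?_⟩
  rw [one_nsmul]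
  have hmem := R.sub_mem hR (h₁ hrel)
  convert hmem using 1
  abel

/-- **EXACTNESS of the g13 carving** modulo the two routine realisation leaves. [folklore] -/
theorem descentTwoQ_iff_carving13 (hPB : TetraPairRealisationLE) (hPT : RealDilogRealisationLE) :
    DescentTwoQ ↔
      TetraKernelModOne ∧ AreaKernelModOne ∧ TorsionDilogKernelModOne ∧ OffTetraOffAreaOffTorsionDescentTwoQ :=
  ⟨fun h => ⟨tetraKernelModOne_of_descentTwoQ_le hPB h, areaKernelModOne_of_descentTwoQ h,
    torsionDilogKernel_of_descentTwoQ hPT h, offTorsion_of_descentTwoQ h⟩,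
    fun h => descentTwoQ_of_carving13 h.1 h.2.1 h.2.2.1 h.2.2.2⟩

/-! ## §6 Non-vacuity: the box family exists (honest `ℚ`-semialgebraic representations of `Li₂(a)`, `a < 1` algebraic) -/

/-- On the closed unit square the denominator `1 − a p₀ p₁` is positive when `a < 1`. [folklore] -/
theorem box_den_pos {a : ℝ} (ha : a < 1) {p : Fin 2 → ℝ} (hp : p ∈ KZ.cube 2) : 0 < 1 - a * p 0 * p 1 := by
  have h0 := hp 0
  have h1 := hp 1
  have hp01 : 0 ≤ p 0 * p 1 := mul_nonneg h0.1 h1.1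
  have hp01' : p 0 * p 1 ≤ 1 := by nlinarith [h0.1, h0.2, h1.1, h1.2]
  rcases le_or_gt a 0 with h | h
  · nlinarith
  · nlinarith

/-- The box integrand `a/(1 − a p₀ p₁)` is a `ℚ`-semialgebraic function on `[0,1]²` for real algebraic `a < 1`
(the constant `a` is `ℚ`-definable). (cite KontsevichZagier2001, §1.1) -/
theorem isSemialgebraicFunOn_box {a : ℝ} (halg : IsAlgebraic ℚ a) (ha : a < 1) :
    IsSemialgebraicFunOn ℚ (KZ.cube 2) (fun p : Fin 2 → ℝ => a / (1 - a * p 0 * p 1)) := by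
  have hD : IsSemialgebraic ℚ (KZ.cube 2) := KZ.isSemialgebraic_cube
  have h0 : IsSemialgebraicFunOn ℚ (KZ.cube 2) (fun w : Fin 2 → ℝ => w 0) := by
    simpa using isSemialgebraicFunOn_aeval hD (X 0 : MvPolynomial (Fin 2) ℚ)
  have h1 : IsSemialgebraicFunOn ℚ (KZ.cube 2) (fun w : Fin 2 → ℝ => w 1) := by
    simpa using isSemialgebraicFunOn_aeval hD (X 1 : MvPolynomial (Fin 2) ℚ)
  have haC : IsSemialgebraicFunOn ℚ (KZ.cube 2) (fun _ : Fin 2 → ℝ => a) :=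
    isSemialgebraicFunOn_const_of_isAlgebraic hD halg
  have hden : IsSemialgebraicFunOn ℚ (KZ.cube 2) (fun w : Fin 2 → ℝ => 1 - a * w 0 * w 1) := by
    have h := IsSemialgebraicFunOn.sub_holds (isSemialgebraicFunOn_natCast hD 1)
      (IsSemialgebraicFunOn.mul_holds (IsSemialgebraicFunOn.mul_holds haC h0) h1)
    refine h.congr fun w _ => ?_
    simp
  refine (haC.div hden fun w hw => (box_den_pos ha hw).ne').congr fun w _ => ?_
  simp

/-- The box integrand is absolutely integrable on `[0,1]²` (continuous on a compact set). [folklore] -/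
theorem integrableOn_box {a : ℝ} (ha : a < 1) :
    IntegrableOn (fun p : Fin 2 → ℝ => a / (1 - a * p 0 * p 1)) (KZ.cube 2) := by
  have hc : ContinuousOn (fun p : Fin 2 → ℝ => a / (1 - a * p 0 * p 1)) (KZ.cube 2) :=
    ContinuousOn.div continuousOn_const (Continuous.continuousOn (by fun_prop))
      fun p hp => (box_den_pos ha hp).ne'
  exact hc.integrableOn_compact KZ.isCompact_cube

/-- **The box representation of `Li₂(a)`** for real algebraic `a < 1`: `[[0,1]², a/(1 − a p₀ p₁)]` — the model of the
landed `stub_boxFiveTerm` (there with `a ∈ ℚ`), an honest `KZ.IntegralRep 2`. (cite Zagier2007Dilogarithm, Ch. I §2) -/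
def boxRep (a : ℝ) (halg : IsAlgebraic ℚ a) (ha : a < 1) : KZ.IntegralRep 2 where
  domain := KZ.cube 2
  integrand := fun p => a / (1 - a * p 0 * p 1)
  isSemialgebraic_domain := KZ.isSemialgebraic_cube
  isSemialgebraicFunOn_integrand := isSemialgebraicFunOn_box halg ha
  integrableOn := integrableOn_box ha

open Classical in
/-- A box family: `boxRep a` where defined, a harmless default elsewhere. [folklore] -/
def boxFamily (a : ℝ) : KZ.IntegralRep 2 :=
  if h : IsAlgebraic ℚ a ∧ a < 1 then boxRep a h.1 h.2 else boxRep 0 isAlgebraic_zero zero_lt_one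

/-- The box family meets the hypothesis of the pieces `T`, `M`, `A″`, `TR`. [folklore] -/
theorem boxFamily_spec : ∀ a : ℝ, IsAlgebraic ℚ a → a < 1 →
    (boxFamily a).domain = KZ.cube 2 ∧
      Set.EqOn (boxFamily a).integrand (fun p : Fin 2 → ℝ => a / (1 - a * p 0 * p 1)) (KZ.cube 2) := by
  intro a halg ha
  have e : boxFamily a = boxRep a halg ha := by
    simp only [boxFamily, dif_pos (show IsAlgebraic ℚ a ∧ a < 1 from ⟨halg, ha⟩)]
  rw [e]
  exact ⟨rfl, fun p _ => rfl⟩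

/-- NON-VACUITY of the box-family hypothesis of `T`, `M`, `A″`, `TR`. [folklore] -/
theorem boxFamily_exists : ∃ β : ℝ → KZ.IntegralRep 2, ∀ a : ℝ, IsAlgebraic ℚ a → a < 1 →
    (β a).domain = KZ.cube 2 ∧ Set.EqOn (β a).integrand (fun p : Fin 2 → ℝ => a / (1 - a * p 0 * p 1)) (KZ.cube 2) :=
  ⟨boxFamily, boxFamily_spec⟩

/-- The arguments `ι α` of the realisation are real ALGEBRAIC numbers (so `β` is constrained exactly where `Φ_β` uses it:
`ι α < 1`, or `(ι α)⁻¹ < 1` when `ι α > 1`). [folklore] -/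
theorem isAlgebraic_embedding {F : Type*} [Field F] [NumberField F] (ι : F →+* ℝ) (a : F) : IsAlgebraic ℚ (ι a) := by
  simpa using (Algebra.IsAlgebraic.isAlgebraic (R := ℚ) a).algHom ι.toRatAlgHom

/-! ## §7 The deciding chain through the route -/

/-- The gen-5 glue `BakerFloorOne → QuadraticDescentOne → DescentTwoQ → KZDimTwo` (pure logic; tree proof
`RootDecompQuadraticDescent.kzDimTwoGlue_proof`). [folklore] -/
theorem kzDimTwo_of_floor (hF : BakerFloorOne) (h₁ : QuadraticDescentOne) (h₁₂ : DescentTwoQ) : KZDimTwo := by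
  have hT : ∀ c ∈ KZ.relations, ∀ y : KZ.FormalRep, c * y ∈ KZ.relations ∧ y * c ∈ KZ.relations := fun c hc y =>
    ⟨KZ.mul_mem_relations_right_holds c y hc, KZ.mul_mem_relations_left_holds c y hc⟩
  have hC : ∀ ⦃n m : ℕ⦄, n ≤ 1 → m ≤ 1 → ∀ (r : KZ.IntegralRep n) (r' : KZ.IntegralRep m),
      r.IsRational → r'.IsRational → r.value = r'.value → KZ.of r - KZ.of r' ∈ KZ.relations :=
    fun n m hn hm r r' hr hr' hv => hF hn hm r r' hr hr' hv
  intro n m hn hm r r' hr hr' hv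
  exact h₁₂ KZ.relations le_rfl hT hC (h₁ KZ.relations le_rfl hT hC) hn hm r r' hr hr' hv

/-- **Deciding chain of the g13-carved route**: floor + level-1 decomposable kernel + B + C + M + A″ + the rungs ⟹ the
summit, through the route's `closes` (T is supplied by `torsionDilogKernel_of_moves`; no named fact is consumed).
[folklore] -/
theorem closes_carving13 (hF : BakerFloorOne) (h₁ : QuadraticDescentOne) (hB : TetraKernelModOne)
    (hC : AreaKernelModOne) (hM : RealRelatorMoves) (hA : OffTetraOffAreaOffTorsionDescentTwoQ)
    (hQ : QuadraticDescent) (h₃ : DescentThreeQ) (h₄ : DescentFourQ) (h₅ : DescentFromQ) : KontsevichZagierPeriods :=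
  closes (kzDimTwo_of_floor hF h₁ (descentTwoQ_of_carving13 hB hC (torsionDilogKernel_of_moves hM) hA)) hQ h₃ h₄ h₅

end Summit.KontsevichZagierPeriods.RootDecompQuadraticDescent.TRRogersCarving
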